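import Summits.BirchSwinnertonDyer.BirchSwinnertonDyer.Theorems.SylvesterTwoHeegnerIndexCMHalfPrep
import Summits.BirchSwinnertonDyer.BirchSwinnertonDyer.Theorems.SylvesterTwoHeegnerIndexThmCDefs
import Summits.BirchSwinnertonDyer.Rank1Residual.X12.CubeSumFamilies
import Literature.NumberTheory.EllipticCurves.HuShuYin2019.SylvesterHeegnerHeightDisplayNamed
import Literature.NumberTheory.EllipticCurves.HeightsProofs
import HarnessLib

/-!
# (S1) of leaf (L1) at `p ≡ 7 (mod 9)`, crux `UpperOffV0HSYPlus` (stmt-BirchSwinnertonDyer-19804):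
# THE HALF-TRACE BOTTOM POINT `Y′ ∈ E_p(K)` — `2 • Y′ = Y₁` (HSY's point) — and its exponent-`0` display,
# from ONE involution `s` of `Gal(K[9p]/K(∛3,∛p))` fixing the bottom CM point

Skeleton of record VARIANT M (`Cruxes/UpperOffV0HSYPlus/Lines/coupled_variantM.lean` 406ca288e244d392), stub
`stub_layerL1Seven`; planner D507 (4).  WHY (k7t-c2 g25 finding, STATUS 2026-08-28T23:40Z): at `p ≡ 7 (9)` HSY's
named point is `Y = 2Y′ + T′` (THEOREM C (★)), so the full-trace classes of the `p ≡ 4 (9)` assembly (g24) have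
their FLIP against `δY = 0`; #23 `layerL1Seven_of_point` needs instead the point with the EXPONENT-`0` display —
the HALVED point — and (L1) for ITS class, i.e. the classes of the HALVED derived points, whose bottom is the half
trace `R′₁ = Σ_{h ∈ H′} h·y₁` over a half `H′` of `H = Gal(K[9p]/K(∛3,∛p))`, `H = H′ ⊔ H′s`, granted an
involution `s ∈ H` with `s·y₁ = y₁` (memo two §67.2 (W2-b) at `n = 1` = THEOREM C's «`σ_{−1}` fixes `P₀`» — an
INPUT, displayed as the binders `s / hsy / H′`, NOT proved and NOT in the tree).

`exists_halfPoint_of_named_of_thmC`: from #19 (`shaAnPair_mul_height_eq_two_zpow_mul_height_named`), (★)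
(`SylvesterTwoNonneg.HSYPointTwoDivisibleSevenModNine`, the stub's own antecedent), the rows' frame data and the
involution datum: HSY's `T₃, Y₁` AND **`Y′ ∈ E_p(K)` with `ι(Y′) = ψ_B κ⁻¹ ι_pt(Σ_{h ∈ H′} h·y₁ + T₃)`,
`2 • Y′ = Y₁`**, and DISP₀(`Y′`) with exponent `0` at every pair of minimal models (= conjunct (a) of #23's
binder `h` at `p ≡ 7 (9)`).  Proof: `R₁ − T₃ = 2(R′₁ + T₃)`; (★) at one pair of minimal models puts
`Y₁ ∈ 2E_p(K)` (odd-order torsion is `2`-divisible, `E_p(K)[2] = 0`); no `2`-torsion in `ψ_B(E₉(K̄)^{N₀})`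
(prep file) identifies the half point with that half; `ĥ(2Q) = 4ĥ(Q)` (`canonicalHeight_nsmul_holds`) turns
HSY's exponent `−2` into `0`.

HONEST LABEL: theorems only (no `def`, no `sorry`, no new `Prop`); (★) and #19 are hypotheses BY NAME; the
involution datum is DISPLAYED; nothing asserted on 19804; no stub closed; X12.CMAtTwo NOT proved; BSD is not
proved by any of this, for any curve.  `set_option maxHeartbeats 800000 in` scoped to the one theorem (statement
with ~40 binders).  `--supports stmt-BirchSwinnertonDyer-19804 --as helper`.
-/

set_option linter.dupNamespace false
set_option autoImplicit false

noncomputable section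

open scoped Classical Pointwise

namespace Summit.BirchSwinnertonDyer.BirchSwinnertonDyer.Theorems.SylvesterTwoCMHalf

open WeierstrassCurve WeierstrassCurve.Affine.Point Field NumberField IsDedekindDomain Finset
open Literature.NumberTheory.EllipticCurves Literature.NumberTheory.GaloisRepresentations
  Literature.NumberTheory.EllipticCurves.ModularForms
  Literature.NumberTheory.EllipticCurves.HuShuYin2019
  Literature.NumberTheory.EllipticCurves.KolyvaginCocycle
  Summit.BirchSwinnertonDyer.BirchSwinnertonDyer.Theorems.SylvesterTwoCMData
  Summit.BirchSwinnertonDyer.BirchSwinnertonDyer.Theorems.SylvesterTwoCMFlip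

variable {K : Type} [Field K] [NumberField K]

/-! ## §1. The half-trace bottom point `Y′ ∈ E_p(K)` with `2 • Y′ = Y` and its exponent-`0` display -/

set_option maxHeartbeats 800000 in
/-- **THE HALF-TRACE BOTTOM POINT at `p ≡ 7 (mod 9)`.**  Frame of the rows (`E₉ = (cubeSumCurve 9)_K`, the
pinned transport `κ : E₉(K̄) ≃ W₀(K̄)`, `W₀ : y² + y = x³ − 1`; the cube root `v_B` of `p/9`, the sextic twist
`ψ_B : E₉(K̄) ≃ E_p(K̄)`, the CM automorphisms `ρ`; the embedded bottom level `K[9p]` — `emb`, `ι_pt`, its fixer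
`N₀`; `∛3, ∛p ∈ K[9p]` and their stabiliser `H ≤ Gal(K[9p]/K)`), HSY's CM point `y₁ ∈ W₀(K[9p])` over
`Dt.φ(τ)` for a degree-`6` parametrisation `Dt`, and THE INVOLUTION DATUM: `s ∈ H` with `s · y₁ = y₁` and a
half `H′` of `H` (`∀ h, Xor (h ∈ H′) (h s ∈ H′)`).  GRANTED the named display #19 (`hD`) and THEOREM C (★)
(`hC`): there are HSY's `3`-torsion point `T₃` and point `Y₁ ∈ E_p(K)` (`ι(Y₁) = ψ_B κ⁻¹ ι_pt(Σ_{h ∈ H} h·y₁ − T₃)`)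
AND **a point `Y′ ∈ E_p(K)` with `ι(Y′) = ψ_B κ⁻¹ ι_pt(Σ_{h ∈ H′} h·y₁ + T₃)` and `2 • Y′ = Y₁`**, such that for
all minimal models `A ≅ E_{3p²}`, `B ≅ E_p` (`C_B • B = E_p`) and `qB = #Ш_an(B)`, `qA = #Ш_an(A)` there are a
`ℚ`-generator `P` of `B` and `Y ∈ B(K)` transporting to `Y′` with `(qB·qA)·ĥ(ιP) = 2⁰·ĥ(Y)` (HSY's exponent
`−2` display for the point transporting to `Y₁ = 2Y′`, and `ĥ(2Q) = 4ĥ(Q)`).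
[cite: HuShuYin2019, Cor. 4.4 (p. 11), display (bsd) (p. 12), §3 p. 8, §2 Prop. 2.4 / Cor. 2.5]
[cite: GrossLMS1991, §4 (4.1)–(4.2), Lemma 4.3] [cite: SilvermanAEC2009, Thm. VIII.9.3 (b)] -/
theorem exists_halfPoint_of_named_of_thmC {ω : K} (hω : ω ^ 2 + ω + 1 = 0) (h2 : Module.finrank ℚ K = 2)
    (ι : K →+* ℂ) (hD : shaAnPair_mul_height_eq_two_zpow_mul_height_named)
    (hC : SylvesterTwoNonneg.HSYPointTwoDivisibleSevenModNine)
    (Dt : ModularParametrizationData (⟨0, 0, 1, 0, -1⟩ : WeierstrassCurve ℚ) 243) (hdeg : Dt.deg = 6)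
    {p : ℕ} (hp : p.Prime) (hp7 : p % 9 = 7) (h3 : ¬ ∃ x : ZMod p, x ^ 3 = 3)
    -- the pinned frame transport
    (κ : geomPoints ((cubeSumCurve 9).baseChange K) ≃+
      geomPoints ((⟨0, 0, 1, 0, -1⟩ : WeierstrassCurve ℚ).baseChange K))
    (hκG : ∀ (g : absoluteGaloisGroup K) (P : geomPoints ((cubeSumCurve 9).baseChange K)),
      κ (g • P) = g • κ P)
    (hκ : ∀ {x y : AlgebraicClosure K}
      (h : (((cubeSumCurve 9).baseChange K).baseChange (AlgebraicClosure K)).toAffine.Nonsingular x y),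
      ∃ h', κ (.some x y h) = .some (x / 36) ((y - 108) / 216) h')
    -- the `B`-side of the coupled frame
    {vB : AlgebraicClosure K} (hvBc : vB ^ 3 = algebraMap ℚ (AlgebraicClosure K) ((p : ℚ) / 9))
    (hvB : vB ≠ 0)
    (hvB3 : ∀ g : absoluteGaloisGroup K,
      ((show AlgebraicClosure K ≃ₐ[K] AlgebraicClosure K from g) vB) ^ 3 = vB ^ 3)
    {ψB : geomPoints ((cubeSumCurve 9).baseChange K) ≃+ geomPoints ((cubeSumCurve (p : ℚ)).baseChange K)}
    (hψB : ∀ {x y : AlgebraicClosure K}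
      (h : (((cubeSumCurve 9).baseChange K).baseChange (AlgebraicClosure K)).toAffine.Nonsingular x y),
      ∃ h', ψB (Affine.Point.some x y h) = Affine.Point.some (vB ^ 2 * x) (vB ^ 3 * y) h')
    {ρ : absoluteGaloisGroup K →
      geomPoints ((cubeSumCurve 9).baseChange K) ≃+ geomPoints ((cubeSumCurve 9).baseChange K)}
    (hρ : ∀ (g : absoluteGaloisGroup K) {x y : AlgebraicClosure K}
        (h : (((cubeSumCurve 9).baseChange K).baseChange (AlgebraicClosure K)).toAffine.Nonsingular x y),
        ∃ h', ρ g (Affine.Point.some x y h) =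
          Affine.Point.some (((show AlgebraicClosure K ≃ₐ[K] AlgebraicClosure K from g) vB / vB) ^ 2 * x)
            y h')
    (hlawB : ∀ (g : absoluteGaloisGroup K) (P : geomPoints ((cubeSumCurve 9).baseChange K)),
        g • ψB P = ψB (ρ g (g • P)))
    -- the embedded bottom level `K[9p]`
    (emb : ringClassField K ι (9 * p) →+* AlgebraicClosure K)
    (hemb : ∀ k : K, emb (algebraMap K (ringClassField K ι (9 * p)) k) = algebraMap K (AlgebraicClosure K) k)
    (ιpt : letI : DecidableEq (ringClassField K ι (9 * p)) := fun a b ↦ Classical.propDecidable (a = b)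
      ((⟨0, 0, 1, 0, -1⟩ : WeierstrassCurve ℚ).baseChange (ringClassField K ι (9 * p))).toAffine.Point →+
        geomPoints (((⟨0, 0, 1, 0, -1⟩ : WeierstrassCurve ℚ)).baseChange K))
    (hιpt : ∀ Q, ιpt Q = Affine.Point.map (W' := (⟨0, 0, 1, 0, -1⟩ : WeierstrassCurve ℚ)) emb.toRatAlgHom Q)
    (N₀ : Subgroup (absoluteGaloisGroup K))
    (hN₀ : ∀ g : absoluteGaloisGroup K, g ∈ N₀ ↔
      ∀ x : ringClassField K ι (9 * p), (show AlgebraicClosure K ≃ₐ[K] AlgebraicClosure K from g) (emb x) = emb x)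
    {c₃ cp : ringClassField K ι (9 * p)} (hc₃ : c₃ ^ 3 = 3) (hcp : cp ^ 3 = (p : ringClassField K ι (9 * p)))
    (H : Subgroup (ringClassField K ι (9 * p) ≃ₐ[K] ringClassField K ι (9 * p)))
    (hH : ∀ σ, σ ∈ H ↔ σ c₃ = c₃ ∧ σ cp = cp) [Fintype H]
    -- THE INVOLUTION DATUM (memo two §67.2 (W2-b) at `n = 1`; displayed, not proved): `s ∈ H`, `s · y₁ = y₁`, a half `H′`
    (s : H) (H' : Finset H) (hH' : ∀ h : H, Xor (h ∈ H') (h * s ∈ H'))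
    (y₁ : ((⟨0, 0, 1, 0, -1⟩ : WeierstrassCurve ℚ).baseChange (ringClassField K ι (9 * p))).toAffine.Point)
    (hy₁ : Affine.Point.map (W' := (⟨0, 0, 1, 0, -1⟩ : WeierstrassCurve ℚ))
        (ringClassField K ι (9 * p)).subtype.toRatAlgHom y₁ =
      Dt.φ (heegnerTau (81 * ((p : ℤ) ^ 2 + 4 * p + 16), -(9 * (4 * (p : ℤ) ^ 2 + 17 * p + 72)),
        4 * (p : ℤ) ^ 2 + 18 * p + 81)))
    (hsy : pointGalHom (⟨0, 0, 1, 0, -1⟩ : WeierstrassCurve ℚ) (ringClassField K ι (9 * p))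
      ((s : _ ≃ₐ[K] _).restrictScalars ℚ) y₁ = y₁) :
    ∃ T₃ : ((⟨0, 0, 1, 0, -1⟩ : WeierstrassCurve ℚ).baseChange (ringClassField K ι (9 * p))).toAffine.Point,
      3 • T₃ = 0 ∧
    ∃ Y₁ Y' : ((cubeSumCurve (p : ℚ)).baseChange K).toAffine.Point,
      toGeomPoints ((cubeSumCurve (p : ℚ)).baseChange K) Y₁ =
        ψB (κ.symm (ιpt ((∑ h : H, pointGalHom (⟨0, 0, 1, 0, -1⟩ : WeierstrassCurve ℚ)
          (ringClassField K ι (9 * p)) ((h : _ ≃ₐ[K] _).restrictScalars ℚ) y₁) - T₃))) ∧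
      toGeomPoints ((cubeSumCurve (p : ℚ)).baseChange K) Y' =
        ψB (κ.symm (ιpt ((∑ h ∈ H', pointGalHom (⟨0, 0, 1, 0, -1⟩ : WeierstrassCurve ℚ)
          (ringClassField K ι (9 * p)) ((h : _ ≃ₐ[K] _).restrictScalars ℚ) y₁) + T₃))) ∧
      (2 : ℕ) • Y' = Y₁ ∧
      ∀ (A B : WeierstrassCurve ℚ) [A.IsElliptic] [A.IsGloballyMinimal] [B.IsElliptic]
          [B.IsGloballyMinimal] (CB : VariableChange ℚ)
          (hCB : CB • B = HuShuYin2019.cubeSumCurve (p : ℚ)),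
        (∃ C : VariableChange ℚ, C • A = HuShuYin2019.cubeSumCurve (3 * (p : ℚ) ^ 2)) →
        ∀ (qB qA : ℚ), shaAn B = (qB : ℂ) → shaAn A = (qA : ℂ) →
        ∃ (P : B.toAffine.Point) (Y : (B.baseChange K).toAffine.Point),
          ¬ IsOfFinAddOrder (WeierstrassCurve.QuadraticDescent.incl K B P) ∧
          (∀ Q : B.toAffine.Point, ∃ m : ℤ, IsOfFinAddOrder
            (WeierstrassCurve.QuadraticDescent.incl K B Q -
              m • WeierstrassCurve.QuadraticDescent.incl K B P)) ∧
          ((qB * qA : ℚ) : ℝ) * canonicalHeight (WeierstrassCurve.QuadraticDescent.incl K B P) =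
            (2 : ℝ) ^ (0 : ℤ) * canonicalHeight Y ∧
          Affine.Point.congrEquiv (congrArg (fun W : WeierstrassCurve ℚ ↦ W.baseChange K) hCB)
            (VariableChange.pointEquivBaseChange B CB K Y) = Y' := by
  -- ### basics
  have hK := JZero.isImaginaryQuadratic_of_sq_add_self_add_one hω h2
  have hp0 : p ≠ 0 := hp.ne_zero
  have hp0' : (p : ℚ) ≠ 0 := by exact_mod_cast hp0
  have hp4 : ¬ p % 9 = 4 := by omega
  have hp2 : Odd p := hp.eq_two_or_odd'.resolve_left (by rintro rfl; norm_num at hp7)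
  have hm0 : 9 * p ≠ 0 := mul_ne_zero (by norm_num) hp0
  haveI := (finiteDimensional_and_isGalois_ringClassField hK ι hm0).1
  haveI := (finiteDimensional_and_isGalois_ringClassField hK ι hm0).2
  haveI hBell : ((cubeSumCurve (p : ℚ)).baseChange K).IsElliptic := isElliptic_cubeSumCurve_baseChange K hp0'
  have hvB' : vB ^ 3 = (p : AlgebraicClosure K) / 9 := by rw [hvBc, eq_ratCast]; push_cast; ring
  -- ### `ι_pt` is additive for the AMBIENT group law (its own is the classical-instance one)
  have hadd : ∀ a b : ((⟨0, 0, 1, 0, -1⟩ : WeierstrassCurve ℚ).baseChange (ringClassField K ι (9 * p))).toAffine.Point,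
      ιpt a + ιpt b = ιpt (a + b) := fun a b ↦ by
    rw [hιpt, hιpt, hιpt]
    exact (map_add (Affine.Point.map (W' := (⟨0, 0, 1, 0, -1⟩ : WeierstrassCurve ℚ)) emb.toRatAlgHom) a b).symm
  have hnsmul : ∀ (n : ℕ)
      (a : ((⟨0, 0, 1, 0, -1⟩ : WeierstrassCurve ℚ).baseChange (ringClassField K ι (9 * p))).toAffine.Point),
      n • ιpt a = ιpt (n • a) := fun n a ↦ by
    induction n with
    | zero => rw [zero_smul, zero_smul, _root_.map_zero]
    | succ n ih => rw [succ_nsmul, succ_nsmul, ih, hadd]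
  have hsub : ∀ a b : ((⟨0, 0, 1, 0, -1⟩ : WeierstrassCurve ℚ).baseChange (ringClassField K ι (9 * p))).toAffine.Point,
      ιpt a - ιpt b = ιpt (a - b) := fun a b ↦ by
    rw [sub_eq_iff_eq_add, hadd, sub_add_cancel]
  -- ### #19 at `p ≡ 7 (9)`: `T₃`, HSY's `Y₁` and the exponent `−2` display for every pair of minimal models
  let G : Finset (ringClassField K ι (9 * p) ≃ₐ[ℚ] ringClassField K ι (9 * p)) :=
    Finset.univ.map ⟨fun h : H ↦ (h : ringClassField K ι (9 * p) ≃ₐ[K] ringClassField K ι (9 * p)).restrictScalars ℚ,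
      fun a b e ↦ Subtype.ext (AlgEquiv.restrictScalars_injective ℚ e)⟩
  have hG : ∀ g, g ∈ G ↔ (∀ k : K, g (algebraMap K (ringClassField K ι (9 * p)) k) =
      algebraMap K (ringClassField K ι (9 * p)) k) ∧ g c₃ = c₃ ∧ g cp = cp := by
    intro g
    constructor
    · intro hg
      obtain ⟨h, -, rfl⟩ := Finset.mem_map.mp hg
      exact ⟨fun k ↦ (h : ringClassField K ι (9 * p) ≃ₐ[K] ringClassField K ι (9 * p)).commutes k, (hH _).mp h.2⟩
    · rintro ⟨hgK, hg3, hgp⟩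
      let h' : ringClassField K ι (9 * p) ≃ₐ[K] ringClassField K ι (9 * p) := { g with commutes' := hgK }
      have hh' : h' ∈ H := (hH h').mpr ⟨hg3, hgp⟩
      exact Finset.mem_map.mpr ⟨⟨h', hh'⟩, Finset.mem_univ _, AlgEquiv.ext fun x ↦ rfl⟩
  obtain ⟨T₃, hT₃, Y₁, hY₁', hall⟩ := (hD p hp (Or.inr hp7) h3 K ω hω h2).2 ι Dt hdeg y₁ hy₁ c₃ cp hc₃ hcp G hG
    emb hemb (Affine.Point.map (W' := (⟨0, 0, 1, 0, -1⟩ : WeierstrassCurve ℚ)) emb.toRatAlgHom) (fun _ ↦ rfl)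
    κ hκ vB hvB' ψB hψB
  have hY₁ : toGeomPoints ((cubeSumCurve (p : ℚ)).baseChange K) Y₁ =
      ψB (κ.symm (ιpt ((∑ h : H, pointGalHom (⟨0, 0, 1, 0, -1⟩ : WeierstrassCurve ℚ) (ringClassField K ι (9 * p))
        ((h : _ ≃ₐ[K] _).restrictScalars ℚ) y₁) - T₃))) := by
    rw [hY₁', Finset.sum_map, hιpt]; rfl
  -- ### the half sum: `Σ_{h ∈ H} h·y₁ = 2 • Σ_{h ∈ H′} h·y₁` (`(h s)·y₁ = h·(s·y₁) = h·y₁`)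
  set R' := ∑ h ∈ H', pointGalHom (⟨0, 0, 1, 0, -1⟩ : WeierstrassCurve ℚ) (ringClassField K ι (9 * p))
      ((h : _ ≃ₐ[K] _).restrictScalars ℚ) y₁ with hR'
  have hfull : ∑ h : H, pointGalHom (⟨0, 0, 1, 0, -1⟩ : WeierstrassCurve ℚ) (ringClassField K ι (9 * p))
      ((h : _ ≃ₐ[K] _).restrictScalars ℚ) y₁ = 2 • R' := by
    rw [hR']
    refine sum_eq_two_nsmul_sum_of_mul_eq s H' hH' _ fun h ↦ ?_
    have e : ((h * s : H) : ringClassField K ι (9 * p) ≃ₐ[K] ringClassField K ι (9 * p)).restrictScalars ℚ =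
        ((h : H) : _ ≃ₐ[K] _).restrictScalars ℚ * ((s : H) : _ ≃ₐ[K] _).restrictScalars ℚ := by
      ext x; rfl
    rw [e, map_mul]
    change pointGalHom _ _ _ (pointGalHom _ _ _ y₁) = _
    rw [hsy]
  -- `R₁ − T₃ = 2 • (R′ + T₃)` since `3 • T₃ = 0`
  have hhalf : (∑ h : H, pointGalHom (⟨0, 0, 1, 0, -1⟩ : WeierstrassCurve ℚ) (ringClassField K ι (9 * p))
      ((h : _ ≃ₐ[K] _).restrictScalars ℚ) y₁) - T₃ = 2 • (R' + T₃) := by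
    rw [hfull, smul_add, sub_eq_iff_eq_add, add_assoc, ← succ_nsmul, hT₃, add_zero]
  set X := ψB (κ.symm (ιpt (R' + T₃))) with hX
  have h2X : toGeomPoints ((cubeSumCurve (p : ℚ)).baseChange K) Y₁ = 2 • X := by
    rw [hY₁, hhalf, ← hnsmul, map_nsmul, map_nsmul]
  -- ### no `2`-torsion in `ψ_B(E₉(K̄)^{N₀})` (prep file §2) — hence none in `E_p(K)` either
  have hNv := apply_vB_eq_of_mem_fixer hω ι hp0 hvBc emb N₀ hN₀ hc₃ hcp
  have hmemK := toGeomPoints_mem_map_fixedPoints (p := p) hψB N₀ hNv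
  have hmemX : X ∈ (FixedPoints.addSubgroup N₀ (geomPoints ((cubeSumCurve 9).baseChange K))).map ψB.toAddMonoidHom :=
    AddSubgroup.mem_map.mpr ⟨κ.symm (ιpt (R' + T₃)), mem_fixedPoints_symm_of_equivariant κ hκG N₀
      (map_emb_mem_fixedPoints (⟨0, 0, 1, 0, -1⟩ : WeierstrassCurve ℚ) ι emb ιpt hιpt N₀ hN₀ _), rfl⟩
  have hkill : ∀ D ∈ (FixedPoints.addSubgroup N₀ (geomPoints ((cubeSumCurve 9).baseChange K))).map ψB.toAddMonoidHom,
      (2 : ℕ) • D = 0 → D = 0 := fun D hD2 h ↦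
    eq_zero_of_two_nsmul_eq_zero_of_mem hω h2 ι hp2 hvB hvB3 hρ hlawB emb hemb N₀ hN₀ hD2 h
  have hnotor : ∀ Z : ((cubeSumCurve (p : ℚ)).baseChange K).toAffine.Point, (2 : ℕ) • Z = 0 → Z = 0 :=
    eq_zero_of_two_nsmul_eq_zero_rat hω h2 ι hp0 hp2 hvBc hvB hvB3 hψB hρ hlawB emb hemb N₀ hN₀ hc₃ hcp
  -- ### (★) at ONE pair of minimal models: `Y₁ ∈ 2 • E_p(K)`
  have hn3 : (3 * (p : ℚ) ^ 2) ≠ 0 := mul_ne_zero (by norm_num) (pow_ne_zero _ hp0')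
  obtain ⟨B₀, _, _, CB₀, hCB₀⟩ := by
    haveI := Summit.BirchSwinnertonDyer.Rank1Residual.X12.CubeSumFamilies.isElliptic_cubeSumCurve hp0'
    exact Summit.BirchSwinnertonDyer.Rank1Residual.X12.CubeSumFamilies.exists_isGloballyMinimal_model
      (cubeSumCurve (p : ℚ))
  obtain ⟨A₀, _, _, CA₀, hCA₀⟩ := by
    haveI := Summit.BirchSwinnertonDyer.Rank1Residual.X12.CubeSumFamilies.isElliptic_cubeSumCurve hn3
    exact Summit.BirchSwinnertonDyer.Rank1Residual.X12.CubeSumFamilies.exists_isGloballyMinimal_model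
      (cubeSumCurve (3 * (p : ℚ) ^ 2))
  obtain ⟨qB₀, qA₀, hqB₀, hqA₀, -, -, P₀, Y₀, hP₀, hgen₀, hdisp₀, htr₀⟩ := hall A₀ B₀ CB₀ hCB₀ ⟨CA₀, hCA₀⟩
  rw [if_neg hp4] at hdisp₀
  obtain ⟨Y₀', T₀', hT₀', hY₀⟩ := hC p hp hp7 h3 A₀ B₀ ⟨CB₀, hCB₀⟩ ⟨CA₀, hCA₀⟩ qB₀ qA₀ hqB₀ hqA₀ K ω hω h2 P₀ hP₀
    hgen₀ Y₀ hdisp₀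
  set tr₀ : (B₀.baseChange K).toAffine.Point ≃+ ((cubeSumCurve (p : ℚ)).baseChange K).toAffine.Point :=
    (VariableChange.pointEquivBaseChange B₀ CB₀ K).trans
      (Affine.Point.congrEquiv (congrArg (fun W : WeierstrassCurve ℚ ↦ W.baseChange K) hCB₀)) with htr₀def
  have hY₁eq : Y₁ = (2 : ℕ) • tr₀ Y₀' + tr₀ T₀' := by
    rw [← htr₀, show Affine.Point.congrEquiv (congrArg (fun W : WeierstrassCurve ℚ ↦ W.baseChange K) hCB₀)
      (VariableChange.pointEquivBaseChange B₀ CB₀ K Y₀) = tr₀ Y₀ from rfl, hY₀, map_add, map_zsmul,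
      show ((2 : ℤ) • tr₀ Y₀' : ((cubeSumCurve (p : ℚ)).baseChange K).toAffine.Point) = (2 : ℕ) • tr₀ Y₀' from by
        rw [show (2 : ℤ) = ((2 : ℕ) : ℤ) from rfl, natCast_zsmul]]
  -- odd-order torsion is `2`-divisible (no `2`-torsion)
  have htor : IsOfFinAddOrder (tr₀ T₀') := by
    have h := tr₀.toAddMonoidHom.isOfFinAddOrder hT₀'
    simpa using h
  obtain ⟨S, hS⟩ : ∃ S : ((cubeSumCurve (p : ℚ)).baseChange K).toAffine.Point, (2 : ℕ) • S = tr₀ T₀' := by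
    set T := tr₀ T₀' with hTdef
    set m := addOrderOf T with hm
    have hmpos : 0 < m := htor.addOrderOf_pos
    rcases Nat.even_or_odd m with ⟨k, hk⟩ | ⟨k, hk⟩
    · exfalso
      have hk0 : 0 < k := by omega
      have hkT : (2 : ℕ) • (k • T) = 0 := by
        rw [← mul_nsmul', show 2 * k = m by omega, hm, addOrderOf_nsmul_eq_zero]
      have hkT0 := hnotor _ hkT
      have hdvd := addOrderOf_dvd_of_nsmul_eq_zero hkT0
      rw [← hm] at hdvd
      have := Nat.le_of_dvd hk0 hdvd
      omega
    · refine ⟨(k + 1) • T, ?_⟩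
      rw [← mul_nsmul', show 2 * (k + 1) = m + 1 by omega, succ_nsmul, hm, addOrderOf_nsmul_eq_zero, zero_add]
  set Y' := tr₀ Y₀' + S with hY'def
  have h2Y' : (2 : ℕ) • Y' = Y₁ := by rw [hY'def, smul_add, hS, hY₁eq]
  -- ### the half point IS `Y′`: `2 • (X − ι(Y′)) = 0` in `A₂`
  have hXY' : X = toGeomPoints ((cubeSumCurve (p : ℚ)).baseChange K) Y' := by
    rw [← sub_eq_zero]
    refine hkill _ (sub_mem hmemX (hmemK Y')) ?_
    rw [smul_sub, ← h2X, ← map_nsmul, h2Y', sub_self]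
  refine ⟨T₃, hT₃, Y₁, Y', hY₁, hXY'.symm, h2Y', ?_⟩
  -- ### DISP₀(Y′) at every pair of minimal models
  intro A B _ _ _ _ CB hCB hA qB qA hqB hqA
  obtain ⟨qB', qA', hB', hA', -, -, P, Y, hP, hgen, hdisp, htr⟩ := hall A B CB hCB hA
  have hqB' : qB' = qB := by exact_mod_cast hB'.symm.trans hqB
  have hqA' : qA' = qA := by exact_mod_cast hA'.symm.trans hqA
  subst hqB' hqA'
  rw [if_neg hp4] at hdisp
  set tr : (B.baseChange K).toAffine.Point ≃+ ((cubeSumCurve (p : ℚ)).baseChange K).toAffine.Point :=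
    (VariableChange.pointEquivBaseChange B CB K).trans
      (Affine.Point.congrEquiv (congrArg (fun W : WeierstrassCurve ℚ ↦ W.baseChange K) hCB)) with htrdef
  have htr' : tr Y = Y₁ := htr
  have hYeq : Y = (2 : ℕ) • tr.symm Y' := by
    apply tr.injective
    rw [htr', map_nsmul, tr.apply_symm_apply, h2Y']
  haveI : (B.baseChange K).IsElliptic := inferInstance
  refine ⟨P, tr.symm Y', hP, hgen, ?_, tr.apply_symm_apply Y'⟩
  rw [hdisp, hYeq, canonicalHeight_nsmul_holds (W := B.baseChange K) 2 (tr.symm Y')]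
  norm_num
  ring

end Summit.BirchSwinnertonDyer.BirchSwinnertonDyer.Theorems.SylvesterTwoCMHalf

end
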